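import Summits.CriticalPhenomena.PercolationContinuityZ3.Theorems.PercNearOneGluingNoHeavyConstsCrossLayerCake
import HarnessLib

/-!
# The u = z CROSS member: layer cake from 0/1-valued monotone functionals to ALL monotone functionals
# (PAPER-2 track (ii): constants of the CSH family; seat `prim-consts-2`, gen 26)

builds on p205010 (kernel theorem, internal audit signed; external expert review pending).  Support file (`--supports
stmt-CriticalPhenomena-4575`); memo `run/shared/lean/prim/consts/FROM-prim-consts-2-g26-SEPARABLE-MARKER.md`.  Theorems only; no definitions,
no sorries, standard axioms.  Companion of `…ConstsCrossLayerCake.lean` (gen 21), which transfers positivity of BOTH CROSS members inside the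
pinned / saturated marker classes; here the same finite layer-cake induction is run for the SECOND member alone and with NO class restriction,
which is what the all-`F` theorems of gen 26 (`…ConstsCrossMarkerZTwoNeighbours`, `…Separable`, `…Necklace`: `M₂(G) ≥ 0` for every monotone
0/1-valued `G` on a graph class) need to reach every monotone functional:
* `Consts.crossM2_nonneg_of_levelSets` — if `M₂(X)(G) = polMargin μ s y z G (X∪u)(X∪u) X + polMargin … (X∪u) X (X∪u) + polMargin … X (X∪u)(X∪u) ≥ 0`
  for every monotone 0/1-valued `G`, then `M₂(X)(F) ≥ 0` for every monotone `F` (finitely many values automatically: the vertex type is finite).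
  Mechanism: `M₂` is linear in `F` and kills constants (`Consts.polMargin_add_mul`, `Consts.polMargin_const'`), and
  `F = max(F, m') + (m' − m)·1{F ≥ m'} − (m' − m)` with `m < m'` the two smallest values of `F` has one value fewer in `max(F, m')`.
[cite: VandenbergHaggstromKahn2005, §2.1 (pp. 9–13)]
-/

noncomputable section

namespace Summit.CriticalPhenomena.PercolationContinuityZ3.Theorems

open MeasureTheory Set Literature.Probability.LatticeModels Literature.Probability.Percolation
open scoped Classical

namespace Consts

variable {V : Type*} [Fintype V]

/-- **Layer cake for the second CROSS member, no class restriction.**  If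
`0 ≤ polMargin μ s y z G (X∪u) (X∪u) X + polMargin μ s y z G (X∪u) X (X∪u) + polMargin μ s y z G X (X∪u) (X∪u)` for every monotone
0/1-valued functional `G` of the open edge cluster, then the same holds for every monotone functional `F`.
[cite: VandenbergHaggstromKahn2005, §2.1 (pp. 9–13)] -/
theorem crossM2_nonneg_of_levelSets (w : Sym2 V → unitInterval) (s y z u : V) (X : Set V)
    (h01 : ∀ G : Set (Sym2 V) → ℝ, Monotone G → (∀ C, G C = 0 ∨ G C = 1) →
      0 ≤ polMargin (prodBernoulli w) s y z G (insert u X) (insert u X) X + polMargin (prodBernoulli w) s y z G (insert u X) X (insert u X) +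
        polMargin (prodBernoulli w) s y z G X (insert u X) (insert u X))
    (F : Set (Sym2 V) → ℝ) (hF : Monotone F) :
    0 ≤ polMargin (prodBernoulli w) s y z F (insert u X) (insert u X) X + polMargin (prodBernoulli w) s y z F (insert u X) X (insert u X) +
      polMargin (prodBernoulli w) s y z F X (insert u X) (insert u X) := by
  -- induct on the number of values of `F`
  suffices key : ∀ (n : ℕ) (F : Set (Sym2 V) → ℝ), Monotone F → (Set.finite_range F).toFinset.card = n →
      0 ≤ polMargin (prodBernoulli w) s y z F (insert u X) (insert u X) X + polMargin (prodBernoulli w) s y z F (insert u X) X (insert u X) +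
        polMargin (prodBernoulli w) s y z F X (insert u X) (insert u X) by
    exact key _ F hF rfl
  intro n
  induction n using Nat.strong_induction_on with
  | _ n ih =>
  intro F hF hn
  by_cases hconst : ∀ C, F C = F ∅
  · -- constant functional: the member vanishes
    have hFc : F = fun _ => F ∅ := funext hconst
    rw [hFc]
    simp only [polMargin_const', add_zero, le_refl]
  push Not at hconst
  obtain ⟨C₀, hC₀⟩ := hconst
  set m := F ∅ with hm
  -- the second-smallest value `m'`
  set T := (Set.finite_range F).toFinset.erase m with hT
  have hTne : T.Nonempty := ⟨F C₀, Finset.mem_erase.mpr ⟨hC₀, (Set.finite_range F).mem_toFinset.mpr ⟨C₀, rfl⟩⟩⟩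
  set m' := T.min' hTne with hm'
  have hm'T : m' ∈ T := Finset.min'_mem T hTne
  have hm'ne : m' ≠ m := (Finset.mem_erase.mp hm'T).1
  have hmin : ∀ C, m ≤ F C := fun C => hF (empty_subset C)
  have hmm' : m < m' := by
    obtain ⟨C, hC⟩ : ∃ C, F C = m' := by
      have := (Finset.mem_erase.mp hm'T).2
      rw [Set.Finite.mem_toFinset] at this
      exact this
    exact lt_of_le_of_ne (hC ▸ hmin C) (Ne.symm hm'ne)
  have hgap : ∀ C, F C < m' → F C = m := by
    intro C hC
    by_contra hne
    have hmem : F C ∈ T := Finset.mem_erase.mpr ⟨hne, (Set.finite_range F).mem_toFinset.mpr ⟨C, rfl⟩⟩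
    exact absurd (Finset.min'_le T (F C) hmem) (not_le.mpr (hm' ▸ hC))
  -- the level-set indicator `G = 1{F ≥ m'}` and the truncated functional `F' = max(F, m')`
  set G : Set (Sym2 V) → ℝ := fun C => if m' ≤ F C then 1 else 0 with hG
  set F' : Set (Sym2 V) → ℝ := fun C => max (F C) m' with hF'
  have hGm : Monotone G := by
    intro C C' hCC'
    simp only [hG]
    by_cases h : m' ≤ F C
    · rw [if_pos h, if_pos (h.trans (hF hCC'))]
    · rw [if_neg h]; split_ifs <;> norm_num
  have hG01 : ∀ C, G C = 0 ∨ G C = 1 := fun C => by simp only [hG]; split_ifs <;> simp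
  have hF'm : Monotone F' := fun C C' hCC' => max_le_max (hF hCC') le_rfl
  -- the decomposition `F = (F' + (m' − m)·G) + (m − m')·1`
  have hdec : F = fun C => (fun C => F' C + (m' - m) * G C) C + (m - m') * (fun _ : Set (Sym2 V) => (1 : ℝ)) C := by
    funext C
    simp only [hF', hG]
    by_cases h : m' ≤ F C
    · rw [if_pos h, max_eq_left h]; ring
    · rw [if_neg h, max_eq_right (not_le.mp h).le, hgap C (not_le.mp h)]; ring
  -- fewer values: `range F' = range F ∖ {m}`
  have hcard : (Set.finite_range F').toFinset.card < n := by
    have hsub : (Set.finite_range F').toFinset = T := by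
      ext v
      simp only [hT, Finset.mem_erase, Set.Finite.mem_toFinset, Set.mem_range]
      constructor
      · rintro ⟨C, rfl⟩
        refine ⟨?_, ?_⟩
        · simp only [hF']; exact ne_of_gt (hmm'.trans_le (le_max_right _ _))
        · by_cases h : m' ≤ F C
          · exact ⟨C, by simp only [hF', max_eq_left h]⟩
          · obtain ⟨C', hC'⟩ : ∃ C', F C' = m' := by
              have := (Finset.mem_erase.mp hm'T).2
              rw [Set.Finite.mem_toFinset] at this
              exact this
            exact ⟨C', by simp only [hF', max_eq_right (not_le.mp h).le, hC']⟩
      · rintro ⟨hne, C, rfl⟩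
        refine ⟨C, ?_⟩
        simp only [hF']
        exact max_eq_left (not_lt.mp fun hlt => hne (hgap C hlt))
    rw [hsub, hT, Finset.card_erase_of_mem ((Set.finite_range F).mem_toFinset.mpr ⟨∅, rfl⟩), hn]
    have : 0 < n := by
      rw [← hn]; exact Finset.card_pos.mpr ⟨m, (Set.finite_range F).mem_toFinset.mpr ⟨∅, rfl⟩⟩
    omega
  have ihF' := ih _ hcard F' hF'm rfl
  have hGpos := h01 G hGm hG01
  have hc : 0 ≤ m' - m := sub_nonneg.mpr hmm'.le
  have p2 := mul_nonneg hc hGpos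
  rw [hdec]
  simp only [polMargin_add_mul, polMargin_const', mul_zero, add_zero]
  nlinarith [ihF', p2]

end Consts

end Summit.CriticalPhenomena.PercolationContinuityZ3.Theorems

end
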